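import Literature.NumberTheory.CubicFields.ThreeTorsionBridge
import HarnessLib

/-!
# `N₃^±(X) = Σ_{0 < ±D < X} #{cubic fields of discriminant D}`: partition of the count by discriminant

Topic `Literature/NumberTheory/CubicFields`; relates `CubicFieldCount.cubicFieldCount s X`
(`N₃^±(X)`, isomorphism classes of cubic fields with `0 < s · Disc < X`) to
`ThreeTorsionBridge.cubicFieldCountOfDisc D` (classes of discriminant exactly `D`).

Bhargava–Taniguchi–Thorne 2023, (3) and p. 3: `N₃^±(X)` counts all cubic fields in the window,
`N^±_{3,fund}(X)` only those of fundamental discriminant; both are sums over `D` of the number of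
cubic fields of discriminant `D` (the discriminant being an isomorphism invariant). Here:

* `discWindow s X` — the integers `D` with `0 < s · D < X`;
* **`cubicFieldCount_eq_sum_cubicFieldCountOfDisc`** — `N₃^s(X) = Σ_{D ∈ discWindow s X} cubicFieldCountOfDisc D`
  (a bijection between classes in the window and the disjoint union over `D` of classes of
  discriminant `D`);
* `sum_fundDiscrs_le_cubicFieldCount_neg/pos` — hence `N^±_{3,fund}(X) ≤ N₃^±(X)`.

## References

* M. Bhargava, T. Taniguchi, F. Thorne, *Improved error estimates for the Davenport–Heilbronn
  theorems*, Math. Ann. 389 (2024) = arXiv:2107.12819, (3), p. 3 [BhargavaTaniguchiThorne2023].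
-/

noncomputable section

namespace Literature.NumberTheory.CubicFields

open NumberField Literature.NumberTheory.QuadraticFields

/-- The window of discriminants `0 < s · D < X`. [folklore] -/
def discWindow (s : ℤ) (X : ℕ) : Finset ℤ :=
  (Finset.Ioo (-(X : ℤ)) X).filter fun D => 0 < s * D ∧ s * D < X

/-- Membership in the window (for `s = ±1`). [folklore] -/
theorem mem_discWindow {s : ℤ} (hs : s = 1 ∨ s = -1) {X : ℕ} {D : ℤ} :
    D ∈ discWindow s X ↔ 0 < s * D ∧ s * D < X := by
  rw [discWindow, Finset.mem_filter, Finset.mem_Ioo]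
  constructor
  · exact fun h => h.2
  · intro h
    refine ⟨?_, h⟩
    rcases hs with rfl | rfl <;> constructor <;> linarith [h.1, h.2]

/-! ### Transport lemmas between the fibres `CubicFieldClassesOfDisc D` -/

/-- Classes of isomorphic fields in fibres over equal discriminants are `HEq`. [folklore] -/
theorem heq_mk_of_nonempty_algEquiv {D D' : ℤ} (h : D = D') (K : cubicSubfieldsOfDisc D) (L : cubicSubfieldsOfDisc D')
    (e : Nonempty ((K : FiniteSubfield) ≃ₐ[ℚ] (L : FiniteSubfield))) :
    HEq (Quotient.mk'' K : CubicFieldClassesOfDisc D) (Quotient.mk'' L : CubicFieldClassesOfDisc D') := by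
  subst h
  exact heq_of_eq (Quotient.sound' e)

/-- Conversely `HEq` classes over equal discriminants come from isomorphic fields. [folklore] -/
theorem nonempty_algEquiv_of_heq_mk {D D' : ℤ} (h : D = D') (K : cubicSubfieldsOfDisc D) (L : cubicSubfieldsOfDisc D')
    (hKL : HEq (Quotient.mk'' K : CubicFieldClassesOfDisc D) (Quotient.mk'' L : CubicFieldClassesOfDisc D')) :
    Nonempty ((K : FiniteSubfield) ≃ₐ[ℚ] (L : FiniteSubfield)) := by
  subst h
  exact Quotient.exact' (eq_of_heq hKL)

/-! ### The bijection and the count -/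

section Count

variable (s : ℤ) [hs : Fact (s = 1 ∨ s = -1)] (X : ℕ)

/-- A cubic subfield in the window has its discriminant in `discWindow`. [folklore] -/
theorem discr_mem_discWindow (K : cubicSubfields s (X : ℝ)) : discr (K : FiniteSubfield) ∈ discWindow s X := by
  obtain ⟨-, h0, hX⟩ := K.2
  rw [mem_discWindow hs.out]
  exact ⟨h0, by exact_mod_cast hX⟩

/-- The map: class of `K` ↦ (`Disc K`, class of `K` among the fields of that discriminant). [folklore] -/
def toSigma : CubicFieldClasses s (X : ℝ) → Σ D : discWindow s X, CubicFieldClassesOfDisc D.1 :=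
  Quotient.lift
    (fun K : cubicSubfields s (X : ℝ) =>
      ⟨⟨discr (K : FiniteSubfield), discr_mem_discWindow s X K⟩,
        Quotient.mk'' (⟨K.1, K.2.1, rfl⟩ : cubicSubfieldsOfDisc (discr (K : FiniteSubfield)))⟩)
    (by
      rintro K L ⟨e⟩
      have hd : discr (K : FiniteSubfield) = discr (L : FiniteSubfield) := NumberField.discr_eq_discr_of_algEquiv _ e
      refine Sigma.ext (Subtype.ext hd) ?_
      exact heq_mk_of_nonempty_algEquiv hd _ _ ⟨e⟩)

/-- `toSigma` is injective. [folklore] -/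
theorem toSigma_injective : Function.Injective (toSigma s X) := by
  intro a b hab
  induction a using Quotient.inductionOn with | h K => ?_
  induction b using Quotient.inductionOn with | h L => ?_
  simp only [toSigma, Quotient.lift_mk, Sigma.mk.injEq, Subtype.mk.injEq] at hab
  obtain ⟨hd, hh⟩ := hab
  exact Quotient.sound (nonempty_algEquiv_of_heq_mk hd _ _ hh)

/-- `toSigma` is surjective. [folklore] -/
theorem toSigma_surjective : Function.Surjective (toSigma s X) := by
  rintro ⟨⟨D, hD⟩, c⟩
  induction c using Quotient.inductionOn with | h K => ?_
  obtain ⟨h3, hK⟩ := K.2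
  have hmem : (K : FiniteSubfield) ∈ cubicSubfields s (X : ℝ) := by
    rw [mem_discWindow hs.out] at hD
    refine ⟨h3, ?_, ?_⟩
    · rw [hK]; exact hD.1
    · rw [hK]; exact_mod_cast hD.2
  refine ⟨Quotient.mk _ ⟨K.1, hmem⟩, ?_⟩
  simp only [toSigma, Quotient.lift_mk]
  refine Sigma.ext (Subtype.ext hK) ?_
  exact heq_mk_of_nonempty_algEquiv hK _ _ ⟨AlgEquiv.refl⟩

/-- **`N₃^s(X) = Σ_{D ∈ discWindow s X} #{cubic fields of discriminant D}`.** [cite: BhargavaTaniguchiThorne2023, (3) (N₃^±(X) as a sum over discriminants of the number of cubic fields of each discriminant)] -/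
theorem cubicFieldCount_eq_sum_cubicFieldCountOfDisc :
    cubicFieldCount s (X : ℝ) = ∑ D ∈ discWindow s X, cubicFieldCountOfDisc D := by
  rw [cubicFieldCount, Nat.card_eq_of_bijective (toSigma s X) ⟨toSigma_injective s X, toSigma_surjective s X⟩,
    Nat.card_sigma, ← Finset.sum_coe_sort (discWindow s X)]
  rfl

end Count

/-- The negative fundamental discriminants in `(−X, 0)` lie in the window `discWindow (−1) X`. [folklore] -/
theorem negFundDiscrs_subset_discWindow (X : ℕ) : negFundDiscrs X ⊆ discWindow (-1) X := by
  intro D hD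
  rw [mem_negFundDiscrs] at hD
  rw [mem_discWindow (Or.inr rfl)]
  constructor <;> linarith [hD.1.1, hD.1.2]

/-- The positive fundamental discriminants in `(0, X)` lie in `discWindow 1 X`. [folklore] -/
theorem posFundDiscrs_subset_discWindow (X : ℕ) : posFundDiscrs X ⊆ discWindow 1 X := by
  intro D hD
  rw [mem_posFundDiscrs] at hD
  rw [mem_discWindow (Or.inl rfl)]
  constructor <;> linarith [hD.1.1, hD.1.2]

/-- **`N⁻_{3,fund}(X) ≤ N₃⁻(X)`**: the cubic fields of negative fundamental discriminant `> −X` are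
among all cubic fields with `−X < Disc < 0`. [folklore] -/
theorem sum_negFundDiscrs_le_cubicFieldCount (X : ℕ) :
    ∑ D ∈ negFundDiscrs X, cubicFieldCountOfDisc D ≤ cubicFieldCount (-1) (X : ℝ) := by
  haveI : Fact ((-1 : ℤ) = 1 ∨ (-1 : ℤ) = -1) := ⟨Or.inr rfl⟩
  rw [cubicFieldCount_eq_sum_cubicFieldCountOfDisc]
  exact Finset.sum_le_sum_of_subset (negFundDiscrs_subset_discWindow X)

/-- **`N⁺_{3,fund}(X) ≤ N₃⁺(X)`.** [folklore] -/
theorem sum_posFundDiscrs_le_cubicFieldCount (X : ℕ) :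
    ∑ D ∈ posFundDiscrs X, cubicFieldCountOfDisc D ≤ cubicFieldCount 1 (X : ℝ) := by
  haveI : Fact ((1 : ℤ) = 1 ∨ (1 : ℤ) = -1) := ⟨Or.inl rfl⟩
  rw [cubicFieldCount_eq_sum_cubicFieldCountOfDisc]
  exact Finset.sum_le_sum_of_subset (posFundDiscrs_subset_discWindow X)

end Literature.NumberTheory.CubicFields

end
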